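import Summits.AtomisticToContinuum.Crystallization.Theses.SquareWellLayerCake

/-!
# Negative knowledge for crux `SquareWellLayerCake.GapTwelveToBarlow` (stmt-AtomisticToContinuum-15807), I:
# the pair-sum obstruction — Barlow windows are centrosymmetric modulo a lattice
# (standing disprover, cycle 1; supports 15807)

`GapTwelveToBarlow` (K3 of route SquareWellLayerCake) is, definitionally (`gapTwelveToBarlow_iff`),
`∀ x, (∀ N, IsGroundState lennardJones (x N)) → (¬Good-fraction → 0) → ∀ R ε, (¬Matched-fraction → 0)`
with `Good` = [the `11/10`-neighbourhood is `55/57`-separated ∧ exactly twelve within `1` ∧ at most twelve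
within `11/10`] and `Matched R ε` = [the `R`-window is two-way `ε`-matched, after a linear isometry, to a
window of some `barlowStacking a h s`, `a, h ∈ (1/2, 2)`].  This file:

* `Good`, `Matched`, `gapTwelveToBarlow_iff`, `GapTwelveToBarlowWithoutIsGroundState` (the crux with the
  ground-state hypothesis deleted; refuted in `Negative.WithoutGroundState`);
* `pairSum_dichotomy` — LATTICE OF DIFFERENCES: for template points `p, p', z` the vector `p + p' − 2z` is
  `0` or has squared norm `≥ min (a²/3) h²` (it lies in `Λ*(a) ⊕ hℤe₃`, `Λ*` triangular of spacing `a/√3`);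
  no hypothesis on `a, h, s`;
* `not_matched_of_short_pairSum` — OBSTRUCTION (boundary lemma for the conclusion predicate): a site with two
  `R`-neighbours whose offsets sum to a vector of norm in `(2ε, 1/(2√3) − 2ε)` is matched to NO Barlow
  template (`a, h > 1/2`; any `s`, `z`, `A`): Barlow windows are centrosymmetric modulo the lattice to
  precision `2ε`;
* `not_matched_of_gap_jump` — the special case of a vertical jump `(g₁ − g₂) e` (a cubic-context layer between
  unequal gaps `g₁ ≠ g₂`): since the template `barlowStacking a h s` has ONE gap `h`, K3 as typed asserts
  a.e. GAP UNIFORMITY to precision `2ε`; relaxed Lennard-Jones polytypes other than the gap-uniform ones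
  (fcc, hcp, dhcp-like) have context-dependent gaps (`δh ≈ 3·10⁻⁵` per context step, crux-dir
  `BarrierNotesIdeator1.md` §B4), so a positive density of such layers in ground states would refute K3
  although every window is informally "Barlow".

Nothing here closes an item; no theorem concludes a Theses decl.
-/

noncomputable section

open scoped BigOperators
open Filter Topology

namespace Summit.AtomisticToContinuum.Crystallization.Theorems.GapTwelveToBarlow.Negative.PairSumObstruction

open Literature.MathematicalPhysics.StatisticalMechanics
open Summit.AtomisticToContinuum.Crystallization.Theses.SquareWellLayerCake

/-! ## §0 The crux's predicates, named verbatim -/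

/-- The hypothesis predicate of the crux at site `i` (verbatim): the `11/10`-neighbourhood is
`55/57`-separated, exactly twelve others within `1`, at most twelve within `11/10`. -/
def Good {N : ℕ} (x : Fin N → (EuclideanSpace ℝ (Fin 3))) (i : Fin N) : Prop :=
  (∀ j : Fin N, dist (x i) (x j) ≤ 11 / 10 → ∀ k : Fin N, k ≠ j → (55 : ℝ) / 57 ≤ dist (x j) (x k)) ∧
  (Finset.univ.filter fun j : Fin N => j ≠ i ∧ dist (x i) (x j) ≤ 1).card = 12 ∧
  (Finset.univ.filter fun j : Fin N => j ≠ i ∧ dist (x i) (x j) ≤ 11 / 10).card ≤ 12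

/-- The conclusion predicate of the crux at site `i` (verbatim): the `R`-window is two-way `ε`-matched,
after a linear isometry, to a window of some Barlow stacking `barlowStacking a h s`. -/
def Matched {N : ℕ} (R ε : ℝ) (x : Fin N → (EuclideanSpace ℝ (Fin 3))) (i : Fin N) : Prop :=
  ∃ a h : ℝ, 1 / 2 < a ∧ a < 2 ∧ 1 / 2 < h ∧ h < 2 ∧ ∃ s : ℤ → ℤ, IsHaggSeq s ∧
    ∃ z ∈ barlowStacking a h s, ∃ A : (EuclideanSpace ℝ (Fin 3)) →ₗᵢ[ℝ] (EuclideanSpace ℝ (Fin 3)),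
      (∀ p ∈ barlowStacking a h s, dist p z ≤ R → ∃ j : Fin N, dist (x j) (x i + A (p - z)) ≤ ε) ∧
      (∀ j : Fin N, dist (x j) (x i) ≤ R → ∃ p ∈ barlowStacking a h s, dist (x j) (x i + A (p - z)) ≤ ε)

/-- NORMAL FORM: the crux is `∀ x, (ground states) → (¬Good-fraction → 0) → ∀ R ε, (¬Matched-fraction → 0)`,
definitionally. -/
theorem gapTwelveToBarlow_iff :
    GapTwelveToBarlow ↔ ∀ x : (N : ℕ) → (Fin N → (EuclideanSpace ℝ (Fin 3))), (∀ N, IsGroundState lennardJones (x N)) →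
      Tendsto (fun N : ℕ => (Nat.card {i : Fin N // ¬ Good (x N) i} : ℝ) / N) atTop (𝓝 0) →
      ∀ R ε : ℝ, 0 < R → 0 < ε → ε < 1 / 4 →
        Tendsto (fun N : ℕ => (Nat.card {i : Fin N // ¬ Matched R ε (x N) i} : ℝ) / N) atTop (𝓝 0) :=
  Iff.rfl

/-- The crux with the ground-state hypothesis `∀ N, IsGroundState lennardJones (x N)` DELETED
(the "energy-free reading": gap-twelve geometry alone would force Barlow windows). -/
def GapTwelveToBarlowWithoutIsGroundState : Prop :=
  ∀ x : (N : ℕ) → (Fin N → (EuclideanSpace ℝ (Fin 3))),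
      Tendsto (fun N : ℕ => (Nat.card {i : Fin N // ¬ Good (x N) i} : ℝ) / N) atTop (𝓝 0) →
      ∀ R ε : ℝ, 0 < R → 0 < ε → ε < 1 / 4 →
        Tendsto (fun N : ℕ => (Nat.card {i : Fin N // ¬ Matched R ε (x N) i} : ℝ) / N) atTop (𝓝 0)

/-! ## §1 The lattice of differences of a Barlow template -/

/-- Coordinates of `p + p' − 2 z` for three template points. [folklore] -/
theorem pairSum_apply (a h : ℝ) (s : ℤ → ℤ) (k₁ i₁ j₁ k₂ i₂ j₂ k₀ i₀ j₀ : ℤ) :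
    let v := barlowPos a h s k₁ i₁ j₁ + barlowPos a h s k₂ i₂ j₂ - (2 : ℝ) • barlowPos a h s k₀ i₀ j₀
    v 0 = a / 2 * ((2 * (i₁ + i₂ - 2 * i₀) + (j₁ + j₂ - 2 * j₀) +
            (haggLabel s k₁ + haggLabel s k₂ - 2 * haggLabel s k₀) : ℤ) : ℝ) ∧
    v 1 = a * √3 / 6 * ((3 * (j₁ + j₂ - 2 * j₀) +
            (haggLabel s k₁ + haggLabel s k₂ - 2 * haggLabel s k₀) : ℤ) : ℝ) ∧
    v 2 = ((k₁ + k₂ - 2 * k₀ : ℤ) : ℝ) * h := by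
  refine ⟨?_, ?_, ?_⟩
  · simp only [PiLp.sub_apply, PiLp.add_apply, PiLp.smul_apply, barlowPos_apply_zero, smul_eq_mul]
    push_cast; ring
  · simp only [PiLp.sub_apply, PiLp.add_apply, PiLp.smul_apply, barlowPos_apply_one, smul_eq_mul]
    push_cast; ring
  · simp only [PiLp.sub_apply, PiLp.add_apply, PiLp.smul_apply, barlowPos_apply_two, smul_eq_mul]
    push_cast; ring

/-- For integers of equal parity, not both zero, `3 P² + Q² ≥ 4`. [folklore] -/
theorem four_le_of_parity {P Q : ℤ} (hpar : Even (P - Q)) (hne : ¬ (P = 0 ∧ Q = 0)) :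
    4 ≤ 3 * P ^ 2 + Q ^ 2 := by
  obtain ⟨t, ht⟩ := hpar
  have sq1 : ∀ n : ℤ, n ≠ 0 → 1 ≤ n ^ 2 := fun n hn => by
    rcases lt_trichotomy n 0 with h | h | h
    · nlinarith
    · exact absurd h hn
    · nlinarith
  by_cases hQ : Q = 0
  · have hP : P ≠ 0 := fun hP => hne ⟨hP, hQ⟩
    have htne : t ≠ 0 := by rintro rfl; apply hP; omega
    have hPt : P = 2 * t := by omega
    have := sq1 t htne
    rw [hPt, hQ]; nlinarith
  · have hQ1 := sq1 Q hQ
    by_cases hP : P = 0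
    · have hQt : Q = -(2 * t) := by omega
      have htne : t ≠ 0 := by rintro rfl; apply hQ; omega
      have := sq1 t htne
      rw [hP, hQt]; nlinarith
    · have := sq1 P hP
      nlinarith

/-- **Lattice of differences.** For any three points `p, p', z` of a Barlow template the vector
`p + p' − 2z` lies in the lattice `Λ*(a) ⊕ h ℤ e₃` (`Λ*` triangular of spacing `a/√3`): it is either `0`
or has squared norm at least `min (a²/3) h²`.  No hypothesis on `a, h, s`. [folklore] -/
theorem pairSum_dichotomy (a h : ℝ) (s : ℤ → ℤ) (k₁ i₁ j₁ k₂ i₂ j₂ k₀ i₀ j₀ : ℤ) :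
    barlowPos a h s k₁ i₁ j₁ + barlowPos a h s k₂ i₂ j₂ - (2 : ℝ) • barlowPos a h s k₀ i₀ j₀ = 0 ∨
    min (a ^ 2 / 3) (h ^ 2) ≤
      ‖barlowPos a h s k₁ i₁ j₁ + barlowPos a h s k₂ i₂ j₂ - (2 : ℝ) • barlowPos a h s k₀ i₀ j₀‖ ^ 2 := by
  obtain ⟨h0, h1, h2⟩ := pairSum_apply a h s k₁ i₁ j₁ k₂ i₂ j₂ k₀ i₀ j₀
  set v := barlowPos a h s k₁ i₁ j₁ + barlowPos a h s k₂ i₂ j₂ - (2 : ℝ) • barlowPos a h s k₀ i₀ j₀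
    with hv
  set P : ℤ := 2 * (i₁ + i₂ - 2 * i₀) + (j₁ + j₂ - 2 * j₀) +
    (haggLabel s k₁ + haggLabel s k₂ - 2 * haggLabel s k₀) with hP
  set Q : ℤ := 3 * (j₁ + j₂ - 2 * j₀) + (haggLabel s k₁ + haggLabel s k₂ - 2 * haggLabel s k₀) with hQ
  set K : ℤ := k₁ + k₂ - 2 * k₀ with hK
  have h3 : (√3 : ℝ) ^ 2 = 3 := Real.sq_sqrt (by norm_num)
  have hnorm : ‖v‖ ^ 2 = a ^ 2 / 12 * (3 * (P : ℝ) ^ 2 + (Q : ℝ) ^ 2) + (K : ℝ) ^ 2 * h ^ 2 := by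
    rw [EuclideanSpace.norm_eq, Real.sq_sqrt (Finset.sum_nonneg fun _ _ => by positivity),
      Fin.sum_univ_three, Real.norm_eq_abs, Real.norm_eq_abs, Real.norm_eq_abs, sq_abs, sq_abs, sq_abs,
      h0, h1, h2]
    linear_combination (a ^ 2 / 36 * (Q : ℝ) ^ 2) * h3
  by_cases hK0 : K = 0
  · by_cases hPQ : P = 0 ∧ Q = 0
    · left
      ext l
      fin_cases l
      · simpa [hPQ.1] using h0
      · simpa [hPQ.2] using h1
      · simpa [hK0] using h2
    · right
      have hpar : Even (P - Q) := ⟨(i₁ + i₂ - 2 * i₀) - (j₁ + j₂ - 2 * j₀), by simp only [hP, hQ]; ring⟩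
      have h4 : (4 : ℝ) ≤ 3 * (P : ℝ) ^ 2 + (Q : ℝ) ^ 2 := by exact_mod_cast four_le_of_parity hpar hPQ
      calc min (a ^ 2 / 3) (h ^ 2) ≤ a ^ 2 / 3 := min_le_left _ _
        _ ≤ a ^ 2 / 12 * (3 * (P : ℝ) ^ 2 + (Q : ℝ) ^ 2) + (K : ℝ) ^ 2 * h ^ 2 := by
            nlinarith [sq_nonneg a, sq_nonneg ((K : ℝ) * h)]
        _ = ‖v‖ ^ 2 := hnorm.symm
  · right
    have hK1 : (1 : ℝ) ≤ (K : ℝ) ^ 2 := by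
      have : (1 : ℤ) ≤ K ^ 2 := by
        rcases lt_trichotomy K 0 with hk | hk | hk
        · nlinarith
        · exact absurd hk hK0
        · nlinarith
      exact_mod_cast this
    calc min (a ^ 2 / 3) (h ^ 2) ≤ h ^ 2 := min_le_right _ _
      _ ≤ a ^ 2 / 12 * (3 * (P : ℝ) ^ 2 + (Q : ℝ) ^ 2) + (K : ℝ) ^ 2 * h ^ 2 := by
          nlinarith [sq_nonneg a, sq_nonneg h, sq_nonneg (P : ℝ), sq_nonneg (Q : ℝ)]
      _ = ‖v‖ ^ 2 := hnorm.symm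

/-! ## §2 The obstruction: short non-zero pair sums are never matched -/

/-- **Pair-sum obstruction (boundary lemma for the conclusion predicate).** If site `i` has two
`R`-neighbours `j, k` with `2ε < ‖(x j − x i) + (x k − x i)‖` and `(‖(x j − x i) + (x k − x i)‖ + 2ε)² < 1/12`,
then `i` is NOT `(R, ε)`-matched to any Barlow template with `a, h > 1/2` (whatever `s`, `z`, `A`):
the two matched template points `p, p'` would give a lattice vector `p + p' − 2z` of norm in
`(0, 1/(2√3))`, excluded by `pairSum_dichotomy`.  In words: Barlow windows are centrosymmetric modulo the
lattice `Λ*(a) ⊕ hℤe₃` to precision `2ε`. [folklore] -/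
theorem not_matched_of_short_pairSum {N : ℕ} {x : Fin N → (EuclideanSpace ℝ (Fin 3))} {i j k : Fin N} {R ε : ℝ}
    (hjR : dist (x j) (x i) ≤ R) (hkR : dist (x k) (x i) ≤ R)
    (hlow : 2 * ε < ‖(x j - x i) + (x k - x i)‖)
    (hup : (‖(x j - x i) + (x k - x i)‖ + 2 * ε) ^ 2 < 1 / 12) :
    ¬ Matched R ε x i := by
  rintro ⟨a, h, ha, -, hh, -, s, -, z, hz, A, -, h2⟩
  obtain ⟨p, hp, hpj⟩ := h2 j hjR
  obtain ⟨p', hp', hpk⟩ := h2 k hkR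
  obtain ⟨k₀, i₀, j₀, rfl⟩ := hz
  obtain ⟨k₁, i₁, j₁, rfl⟩ := hp
  obtain ⟨k₂, i₂, j₂, rfl⟩ := hp'
  set z := barlowPos a h s k₀ i₀ j₀ with hzdef
  set p := barlowPos a h s k₁ i₁ j₁ with hpdef
  set p' := barlowPos a h s k₂ i₂ j₂ with hp'def
  set w := (x j - x i) + (x k - x i) with hw
  have hv : A (p - z) + A (p' - z) = A (p + p' - (2 : ℝ) • z) := by
    rw [← map_add]; congr 1; module
  rw [dist_eq_norm] at hpj hpk
  have e1 : x j - (x i + A (p - z)) = (x j - x i) - A (p - z) := by abel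
  have e2 : x k - (x i + A (p' - z)) = (x k - x i) - A (p' - z) := by abel
  rw [e1] at hpj
  rw [e2] at hpk
  have htri : ‖w - A (p + p' - (2 : ℝ) • z)‖ ≤ 2 * ε := by
    calc ‖w - A (p + p' - (2 : ℝ) • z)‖ = ‖((x j - x i) - A (p - z)) + ((x k - x i) - A (p' - z))‖ := by
          rw [← hv, hw]; congr 1; abel
      _ ≤ ‖(x j - x i) - A (p - z)‖ + ‖(x k - x i) - A (p' - z)‖ := norm_add_le _ _
      _ ≤ 2 * ε := by linarith
  have hAv : ‖A (p + p' - (2 : ℝ) • z)‖ = ‖p + p' - (2 : ℝ) • z‖ := A.norm_map _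
  have hlow' : ‖w‖ - 2 * ε ≤ ‖p + p' - (2 : ℝ) • z‖ := by
    have := norm_sub_norm_le w (A (p + p' - (2 : ℝ) • z))
    linarith
  have hup' : ‖p + p' - (2 : ℝ) • z‖ ≤ ‖w‖ + 2 * ε := by
    have := norm_sub_norm_le (A (p + p' - (2 : ℝ) • z)) w
    rw [norm_sub_rev] at this
    linarith
  rcases pairSum_dichotomy a h s k₁ i₁ j₁ k₂ i₂ j₂ k₀ i₀ j₀ with h0 | hmin
  · have h0' : p + p' - (2 : ℝ) • z = 0 := h0
    have : ‖p + p' - (2 : ℝ) • z‖ = 0 := by rw [h0', norm_zero]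
    linarith
  · have hmin' : (1 : ℝ) / 12 < min (a ^ 2 / 3) (h ^ 2) := by
      rw [lt_min_iff]; constructor <;> nlinarith
    have hnn : 0 ≤ ‖p + p' - (2 : ℝ) • z‖ := norm_nonneg _
    have hsq : ‖p + p' - (2 : ℝ) • z‖ ^ 2 ≤ (‖w‖ + 2 * ε) ^ 2 := by
      have hε : 0 ≤ ‖w‖ + 2 * ε := le_trans hnn hup'
      nlinarith
    have : min (a ^ 2 / 3) (h ^ 2) ≤ ‖p + p' - (2 : ℝ) • z‖ ^ 2 := hmin
    linarith

/-- **Gap-jump corollary (template adequacy).**  If site `i` has `R`-neighbours `j` (above) and `k`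
(below) with offsets `ω + g₁ e` and `−ω − g₂ e` for a unit vector `e` — a cubic-context layer between layer
gaps `g₁` (up) and `g₂` (down) — then `i` is unmatched as soon as `2ε < |g₁ − g₂|` and
`(|g₁ − g₂| + 2ε)² < 1/12`: the conclusion's template `barlowStacking a h s` has ONE gap `h`, so K3 as typed
asserts a.e. gap uniformity to precision `2ε` at every cubic-context layer (relaxed 6H/9R-type polytypes,
twin and fault neighbourhoods have `g₁ ≠ g₂`). [folklore] -/
theorem not_matched_of_gap_jump {N : ℕ} {x : Fin N → (EuclideanSpace ℝ (Fin 3))} {i j k : Fin N} {R ε g₁ g₂ : ℝ} {ω e : (EuclideanSpace ℝ (Fin 3))}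
    (he : ‖e‖ = 1) (hjR : dist (x j) (x i) ≤ R) (hkR : dist (x k) (x i) ≤ R)
    (hj : x j - x i = ω + g₁ • e) (hk : x k - x i = -ω - g₂ • e)
    (hlow : 2 * ε < |g₁ - g₂|) (hup : (|g₁ - g₂| + 2 * ε) ^ 2 < 1 / 12) :
    ¬ Matched R ε x i := by
  have hsum : (x j - x i) + (x k - x i) = (g₁ - g₂) • e := by rw [hj, hk]; module
  have hnorm : ‖(x j - x i) + (x k - x i)‖ = |g₁ - g₂| := by
    rw [hsum, norm_smul, he, mul_one, Real.norm_eq_abs]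
  exact not_matched_of_short_pairSum hjR hkR (hnorm ▸ hlow) (hnorm ▸ hup)

end Summit.AtomisticToContinuum.Crystallization.Theorems.GapTwelveToBarlow.Negative.PairSumObstruction
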